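import Summits.QuantumAdvantage.AdviceFreeQNC0.AffBells22FrameAveraging
import Summits.QuantumAdvantage.AdviceFreeQNC0.AffBells22FrameIdentity
import Summits.QuantumAdvantage.AdviceFreeQNC0.SparseRead39B
import Summits.QuantumAdvantage.AdviceFreeQNC0.Blind39
import HarnessLib

/-!
# Cell qa-qnc0, `p = 3` — (R1) AT `C = 0` IN FULL (far reads included) and the TRANSVERSAL FORM of (R1), by the
# kernel-line FIBRE METHOD (prover qn-prover-3 g25; closes planner qa-qnc0-p1 g39's ask A39-9 and the typed targets
# `SparseRead39.R1One`, `Blind39.OneLetterTwistBound`)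

Planner qa-qnc0-p1 g39 (ROUND-38 §6.4.4) reduced (R1) at `C = 0` — bells reading `x|_W` and ONE further letter `x_{i k}` — to a
worst-case PINNED twist bound (`SparseRead39.TwistBoundZAffinePinned`, open), proved the near-read part (`r1OneFar`, register chain
`Pinned39*`) and isolated FAR reads (`|i k − k| ≥ 2`) as the open content.  This file settles the whole `C = 0` case (and more) without
pins and without the register chain, by the FIBRE METHOD that has been in the tree since planner qa-qnc0-p1 g22
(`AffBells22FibreSum`, `AffBells22FrozenTwist`, `AffBells22FrameAveraging.norm_twist_sum_le_junta`):

* group the odd patterns `x` by their kernel line `J = J(x)` (`Fib19.kline`); on the fibre of `J` the bits on `supp J` are forced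
  and the bits at the zeros of `J` ("coins") are free (`Fib19.inKernel_iff_forced`);
* the win sign `(−1)^{⟨J(x), stake(g,x)⟩}` of a strategy whose bell `k` reads `T k` is, for FIXED values of the coins outside a set
  `A` meeting every `T k` at most once, a product of one-coin factors over the coins in `A`; with the character `e₃(β·x)` each twisted
  coin of `A` contributes `|1 ± ω^{±1}| ≤ √3` instead of `2` (`norm_fibre_twist_le_junta`);
* the kernel lines are linear hard-core words, and the weighted hard-core sum with weights `2` / `√3` is `≤ (200/39)(39/40)^{#A} 2^{N−1}`
  (`AffBells22HardcoreWords`, `total_le_two_mixed`).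

The point missed in ROUND-38 §6.4.4: the transversal condition `#(T k ∩ A) ≤ 1` does not care how large `T k` is OFF `A`.  Taking
`T k = W ∪ {i k}` and `A = supp β ∖ W` gives (R1) at `C = 0` for EVERY `W` (no `3·#W ≤ N`), EVERY reader map `i` (near or far) and a
CONSTANT in place of `N^A`:

* `AffBells22.norm_oddClass_char_le` — the strategy-free term `‖Σ_{x odd} e₃(β·x)‖ ≤ Π_i (β_i ≠ 0 ? √3 : 2)`;
* **`AffBells22.norm_twistedWinSum_le_of_transversal`** — THE TRANSVERSAL FORM of (R1): if bell `k` reads only `T k` and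
  `A ⊆ supp β` meets every `T k` in at most one letter, then `‖Σ_x e₃(β·x)[OddZeros x ∧ Rel x (g x)]‖ ≤ 2·(39/40)^{#A}·2^N` (`N ≥ 3`);
* **`SparseRead39.r1One : R1One (39/40)`** — (R1)₁, the strong form of (R1) at `C = 0` (planner p1 g39's typed target, `SparseRead39B`),
  hence `R1Zero`, `R1OneFar` again, and `TwistBoundZAffinePinned` is no longer needed by the line;
* **`Blind39.oneLetterTwistBound : OneLetterTwistBound (39/40)`** — (R1)_{s=1}, ROUND-38 §6.4's "recommended next target" (typed in
  `Blind39`): bells reading one letter each, arbitrary positions and multiplicities;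
* `GradedSeeds38.twistedJuntaBoundX3S_zero` — the literal `C = 0` instance of `TwistedJunta36.TwistedJuntaBoundX3S (39/40)`.

What remains open of (R1) is exactly the case where NO large transversal exists (outside-reads `T k ∖ W` of size `≤ (log₂N)^C` covering
the twisted letters with heavy pairwise overlaps — planner p1's Claim K regime); pairwise-disjoint outside-reads always admit a
transversal of size `≥ #(supp β ∖ W)/(log₂N)^C` (sequel).

WHAT THIS IS NOT: (R1) for `C ≥ 1` with overlapping juntas is untouched; crux `stmt-QuantumAdvantage-22907` untouched.
-/

noncomputable section

namespace Summit.QuantumAdvantage.AdviceFreeQNC0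

open Finset Literature.Computability.QuantumComplexity Literature.Computability.QuantumComplexity.RingHLF
open Literature.Computability.MetaComplexity
open scoped Classical

namespace AffBells22

variable {N : ℕ}

/-! ## The strategy-free term -/

/-- The zeros sign `x ↦ Π_i (−1)^{[x_i = 0]}` is a coordinate product on the full cube. -/
theorem isCoordProduct_zerosSign_cube : IsCoordProduct (fun x : Fin N → Bool => ∏ i : Fin N, sgnB (!x i)) :=
  ⟨1, Or.inl rfl, fun _ b => sgnB (!b), fun _ b => sgnB_cases _, fun v => by rw [one_mul]⟩

/-- **The strategy-free term**: `‖Σ_{x odd} e₃(β·x)‖ ≤ Π_i (β_i ≠ 0 ? √3 : 2)` (oddness indicator `= (1 − Π_i (−1)^{[x_i=0]})/2`,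
two coordinate-product-times-character sums over the full cube). -/
theorem norm_oddClass_char_le (β : Fin N → ZMod 3) :
    ‖∑ x ∈ (univ : Finset (Fin N → Bool)).filter (fun x => Fib19.IsOdd x),
        (ZMod.stdAddChar (∑ i : Fin N, if x i then β i else 0) : ℂ)‖
      ≤ ∏ i : Fin N, (if β i ≠ 0 then Real.sqrt 3 else 2) := by
  classical
  set χ : (Fin N → Bool) → ℂ := fun x => (ZMod.stdAddChar (∑ i : Fin N, if x i then β i else 0) : ℂ) with hχ
  set P : (Fin N → Bool) → ℂ := fun x => ∏ i : Fin N, sgnB (!x i) with hP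
  have hrw : (∑ x ∈ (univ : Finset (Fin N → Bool)).filter (fun x => Fib19.IsOdd x), χ x)
      = ((∑ x : Fin N → Bool, (1 : ℂ) * χ x) - ∑ x : Fin N → Bool, P x * χ x) / 2 := by
    rw [sum_filter]
    have hterm : ∀ x : Fin N → Bool, (if Fib19.IsOdd x then χ x else 0) = ((1 : ℂ) * χ x - P x * χ x) / 2 := by
      intro x
      have h1 : (if Fib19.IsOdd x then χ x else 0) = (if Fib19.IsOdd x then (1 : ℂ) else 0) * χ x := by
        split_ifs <;> simp
      rw [h1, isOdd_indicator_eq]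
      ring
    rw [sum_congr rfl fun x _ => hterm x, ← sum_div, sum_sub_distrib]
  rw [hrw, norm_div, RCLike.norm_ofNat]
  have h1 := norm_sum_coordProduct_mul_char_le (isCoordProduct_const (ι := Fin N) (c := (1 : ℂ)) (Or.inl rfl)) β
  have h2 := norm_sum_coordProduct_mul_char_le (isCoordProduct_zerosSign_cube (N := N)) β
  calc ‖(∑ x : Fin N → Bool, (1 : ℂ) * χ x) - ∑ x : Fin N → Bool, P x * χ x‖ / 2
      ≤ (‖∑ x : Fin N → Bool, (1 : ℂ) * χ x‖ + ‖∑ x : Fin N → Bool, P x * χ x‖) / 2 := by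
        gcongr; exact norm_sub_le _ _
    _ ≤ ((∏ i : Fin N, (if β i ≠ 0 then Real.sqrt 3 else 2)) + ∏ i : Fin N, (if β i ≠ 0 then Real.sqrt 3 else 2)) / 2 := by
        gcongr
    _ = ∏ i : Fin N, (if β i ≠ 0 then Real.sqrt 3 else 2) := by ring

/-- `Π_i (β_i ≠ 0 ? √3 : 2) ≤ (39/40)^{#supp β} · 2^N` (since `√3 ≤ 7/4 ≤ 2·(39/40)`). -/
theorem prod_wt_le_pow (β : Fin N → ZMod 3) :
    (∏ i : Fin N, (if β i ≠ 0 then Real.sqrt 3 else 2))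
      ≤ (39 / 40 : ℝ) ^ (univ.filter fun i : Fin N => β i ≠ 0).card * (2 : ℝ) ^ N := by
  classical
  have hle : ∀ i ∈ (univ : Finset (Fin N)),
      (if β i ≠ 0 then Real.sqrt 3 else 2) ≤ (if β i ≠ 0 then (39 / 20 : ℝ) else 2) := by
    intro i _
    split_ifs
    · linarith [sqrt_three_le]
    · exact le_rfl
  have hnn : ∀ i ∈ (univ : Finset (Fin N)), (0 : ℝ) ≤ (if β i ≠ 0 then Real.sqrt 3 else 2) := by
    intro i _; split_ifs <;> positivity
  refine (prod_le_prod hnn hle).trans (le_of_eq ?_)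
  rw [prod_ite, prod_const, prod_const]
  have hcard : (univ.filter fun i : Fin N => ¬ β i ≠ 0).card = N - (univ.filter fun i : Fin N => β i ≠ 0).card := by
    have h := card_filter_add_card_filter_not (s := (univ : Finset (Fin N))) (fun i : Fin N => β i ≠ 0)
    rw [card_univ, Fintype.card_fin] at h
    omega
  rw [hcard]
  set w := (univ.filter fun i : Fin N => β i ≠ 0).card with hw
  have hwN : w ≤ N := by
    rw [hw]; exact (card_filter_le _ _).trans (by rw [card_univ, Fintype.card_fin])
  have h2 : (2 : ℝ) ^ N = 2 ^ w * 2 ^ (N - w) := by rw [← pow_add, Nat.add_sub_cancel' hwN]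
  rw [h2, ← mul_assoc, ← mul_pow]
  norm_num

/-! ## The transversal form of (R1) -/

/-- Each term of a twisted win sum has norm `≤ 1`, so the sum is trivially `≤ 2^N`. -/
theorem norm_twistedWinSum_le_trivial (β : Fin N → ZMod 3) (g : Fin N → (Fin N → Bool) → Bool) :
    ‖∑ x : Fin N → Bool, (ZMod.stdAddChar (∑ i : Fin N, if x i then β i else 0) : ℂ) *
        (if (OddZeros x ∧ RingHLF.Rel x (fun k => g k x)) then (1 : ℂ) else 0)‖ ≤ (2 : ℝ) ^ N := by
  classical
  refine (norm_sum_le _ _).trans ?_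
  calc ∑ x : Fin N → Bool, ‖(ZMod.stdAddChar (∑ i : Fin N, if x i then β i else 0) : ℂ) *
          (if (OddZeros x ∧ RingHLF.Rel x (fun k => g k x)) then (1 : ℂ) else 0)‖
      ≤ ∑ _x : Fin N → Bool, (1 : ℝ) := by
        refine sum_le_sum fun x _ => ?_
        rw [norm_mul, AffBells21.norm_stdAddChar_three, one_mul]
        split_ifs <;> simp
    _ = (2 : ℝ) ^ N := by simp

/-- **THE TRANSVERSAL FORM OF (R1)** (kernel-line fibre method).  If bell `k` reads only the letters in `T k` and `A ⊆ supp β` is a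
TRANSVERSAL of the reading sets (`#(T k ∩ A) ≤ 1` for all `k`; the `T k` may be arbitrarily large off `A`), then
`‖Σ_x e₃(β·x)·[OddZeros x ∧ Rel x (g x)]‖ ≤ 2 · (39/40)^{#A} · 2^N` (`N ≥ 3`).  Proof: `[WIN] = (1 − (−1)^{⟨J(x),stake⟩})/2` on the odd
class (`win_indicator_eq`), the strategy-free term by `norm_oddClass_char_le`, the signed term by `norm_twist_sum_le_junta`. -/
theorem norm_twistedWinSum_le_of_transversal (hN : 3 ≤ N) (T : Fin N → Finset (Fin N)) (g : Fin N → (Fin N → Bool) → Bool)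
    (hg : ∀ k, ReadsOnly (T k) (g k)) (β : Fin N → ZMod 3) (A : Finset (Fin N))
    (hA : ∀ k, (T k ∩ A).card ≤ 1) (hAβ : ∀ i ∈ A, β i ≠ 0) :
    ‖∑ x : Fin N → Bool, (ZMod.stdAddChar (∑ i : Fin N, if x i then β i else 0) : ℂ) *
        (if (OddZeros x ∧ RingHLF.Rel x (fun k => g k x)) then (1 : ℂ) else 0)‖
      ≤ 2 * (39 / 40 : ℝ) ^ A.card * (2 : ℝ) ^ N := by
  classical
  set χ : (Fin N → Bool) → ℂ := fun x => (ZMod.stdAddChar (∑ i : Fin N, if x i then β i else 0) : ℂ) with hχ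
  set s : (Fin N → Bool) → ℂ := fun x =>
    (-1 : ℂ) ^ dot2 (Fib19.kline x) (Fib19.stake (fun x k => g k x) x) with hs
  set O := (univ : Finset (Fin N → Bool)).filter (fun x => Fib19.IsOdd x) with hO
  -- pointwise: `e₃(β·x)·[odd ∧ WIN] = [odd]·(e₃ − s·e₃)/2`
  have hterm : ∀ x : Fin N → Bool,
      χ x * (if (OddZeros x ∧ RingHLF.Rel x (fun k => g k x)) then (1 : ℂ) else 0)
        = if Fib19.IsOdd x then (χ x - s x * χ x) / 2 else 0 := by
    intro x
    by_cases hx : Fib19.IsOdd x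
    · have hox : OddZeros x := (Fib19.isOdd_iff_oddZeros x).mp hx
      rw [if_pos hx]
      have hw := win_indicator_eq hN (fun x k => g k x) x hx
      have e : (if (OddZeros x ∧ RingHLF.Rel x (fun k => g k x)) then (1 : ℂ) else 0)
          = (if RingHLF.Rel x ((fun x k => g k x) x) then (1 : ℂ) else 0) := by
        simp only [hox, true_and]
      rw [e, hw]
      ring
    · have hox : ¬ OddZeros x := fun h => hx ((Fib19.isOdd_iff_oddZeros x).mpr h)
      rw [if_neg hx, if_neg (fun h => hox h.1), mul_zero]
  have hsplit : (∑ x : Fin N → Bool, χ x * (if (OddZeros x ∧ RingHLF.Rel x (fun k => g k x)) then (1 : ℂ) else 0))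
      = ((∑ x ∈ O, χ x) - ∑ x ∈ O, s x * χ x) / 2 := by
    rw [sum_congr rfl fun x _ => hterm x, ← sum_filter, ← sum_div, sum_sub_distrib]
  rw [hsplit, norm_div, RCLike.norm_ofNat]
  -- the two terms
  have h1 : ‖∑ x ∈ O, χ x‖ ≤ (39 / 40 : ℝ) ^ A.card * (2 : ℝ) ^ N := by
    refine ((norm_oddClass_char_le β).trans (prod_wt_le_pow β)).trans ?_
    have hAsub : A ⊆ univ.filter (fun i : Fin N => β i ≠ 0) := fun i hi => mem_filter.mpr ⟨mem_univ _, hAβ i hi⟩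
    have hcard : A.card ≤ (univ.filter fun i : Fin N => β i ≠ 0).card := card_le_card hAsub
    have hpow : (39 / 40 : ℝ) ^ (univ.filter fun i : Fin N => β i ≠ 0).card ≤ (39 / 40 : ℝ) ^ A.card :=
      pow_le_pow_of_le_one (by norm_num) (by norm_num) hcard
    exact mul_le_mul_of_nonneg_right hpow (by positivity)
  have h2 : ‖∑ x ∈ O, s x * χ x‖ ≤ 200 / 39 * (39 / 40 : ℝ) ^ A.card * (2 : ℝ) ^ (N - 1) :=
    norm_twist_sum_le_junta hN T g hg β A hA hAβ
  have h2N : (2 : ℝ) ^ (N - 1) = 2 ^ N / 2 := by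
    obtain ⟨m, rfl⟩ : ∃ m, N = m + 1 := ⟨N - 1, by omega⟩
    rw [Nat.add_sub_cancel, pow_succ]; ring
  rw [h2N] at h2
  have hpos : (0 : ℝ) ≤ (39 / 40 : ℝ) ^ A.card * (2 : ℝ) ^ N := by positivity
  calc ‖(∑ x ∈ O, χ x) - ∑ x ∈ O, s x * χ x‖ / 2
      ≤ (‖∑ x ∈ O, χ x‖ + ‖∑ x ∈ O, s x * χ x‖) / 2 := by gcongr; exact norm_sub_le _ _
    _ ≤ ((39 / 40 : ℝ) ^ A.card * (2 : ℝ) ^ N + 200 / 39 * (39 / 40 : ℝ) ^ A.card * (2 ^ N / 2)) / 2 := by gcongr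
    _ ≤ 2 * (39 / 40 : ℝ) ^ A.card * (2 : ℝ) ^ N := by nlinarith [hpos]

end AffBells22

/-! ## (R1) at `C = 0` in full: `R1One`, `OneLetterTwistBound`, the `C = 0` instance of `TwistedJuntaBoundX3S` -/

namespace SparseRead39

open AffBells22

/-- **`(R1)₁` PROVED: `R1One (39/40)`** — every strategy whose bell `k` is determined by `x|_W` and ONE further letter `x_{i k}`
(`W`, `i` ARBITRARY: no `3·#W ≤ N`, near or far reads, any multiplicity) obeys
`‖Σ_x e₃(β·x)[OddZeros x ∧ Rel x (g x)]‖ ≤ 2·(39/40)^{#{j ∉ W : β_j ≠ 0}}·2^N`.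
(Transversal form with `T k = insert (i k) W`, `A = supp β ∖ W`; `N ≤ 2` by the trivial bound.) -/
theorem r1One : R1One (39 / 40 : ℝ) := by
  classical
  refine ⟨2, fun N W i g hg β => ?_⟩
  set A := univ.filter (fun j : Fin N => j ∉ W ∧ β j ≠ 0) with hAdef
  by_cases hN : 3 ≤ N
  · have hT : ∀ k, ReadsOnly (insert (i k) W) (g k) := by
      intro k x x' hxx'
      exact hg k x x' (fun j hj => hxx' j (mem_insert_of_mem hj)) (hxx' (i k) (mem_insert_self _ _))
    have hA : ∀ k, (insert (i k) W ∩ A).card ≤ 1 := by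
      intro k
      have hsub : insert (i k) W ∩ A ⊆ {i k} := by
        intro j hj
        rw [mem_inter, mem_insert] at hj
        rcases hj.1 with h | h
        · exact mem_singleton.mpr h
        · exact absurd h (mem_filter.mp hj.2).2.1
      exact (card_le_card hsub).trans (by simp)
    have hAβ : ∀ j ∈ A, β j ≠ 0 := fun j hj => (mem_filter.mp hj).2.2
    exact norm_twistedWinSum_le_of_transversal hN (fun k => insert (i k) W) g hT β A hA hAβ
  · -- `N ≤ 2`: trivial bound `2^N ≤ 2·(39/40)^{#A}·2^N` since `#A ≤ N ≤ 2`
    refine (norm_twistedWinSum_le_trivial β g).trans ?_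
    have hcard : A.card ≤ 2 := (card_filter_le _ _).trans (by rw [card_univ, Fintype.card_fin]; omega)
    have hpow : (39 / 40 : ℝ) ^ 2 ≤ (39 / 40 : ℝ) ^ A.card := pow_le_pow_of_le_one (by norm_num) (by norm_num) hcard
    have h2 : (0 : ℝ) ≤ (2 : ℝ) ^ N := by positivity
    nlinarith [hpow, h2]

/-- `R1One` gives `R1Zero` back (planner p1 g39's `(R1)₀`, already a tree theorem via the register chain: `r1Zero`). -/
theorem r1Zero_of_r1One {ρ : ℝ} (h : R1One ρ) : R1Zero ρ := by
  obtain ⟨A, hA⟩ := h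
  refine ⟨A, fun N W g hg β => ?_⟩
  have := hA N W (fun k => k) g (fun k x x' hW _ => hg k x x' hW) β
  exact this

/-- Hence `(R1)₀` with `ρ = 39/40` by the fibre method (second proof of `SparseRead39.r1Zero`'s content, explicit constants). -/
theorem r1Zero' : R1Zero (39 / 40 : ℝ) := r1Zero_of_r1One r1One

end SparseRead39

namespace Blind39

open AffBells22

/-- **`(R1)_{s=1}` PROVED: `OneLetterTwistBound (39/40)`** (ROUND-38 §6.4, planner p1 g39's "recommended next target") — bells
reading ONE letter each at arbitrary positions (constant bells = trivial readers): `‖Σ_x e₃(β·x)[OddZeros x ∧ Rel x (G_k(x_{τ k}))_k]‖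
≤ N·(39/40)^{wt β}·2^N` for `N ≥ 3` (transversal `A = supp β`). -/
theorem oneLetterTwistBound : OneLetterTwistBound (39 / 40 : ℝ) := by
  classical
  refine ⟨1, 3, fun N hN τ G β => ?_⟩
  set A := univ.filter (fun j : Fin N => β j ≠ 0) with hAdef
  have hT : ∀ k, ReadsOnly ({τ k} : Finset (Fin N)) (fun x : Fin N → Bool => G k (x (τ k))) := by
    intro k x x' hxx'
    show G k (x (τ k)) = G k (x' (τ k))
    rw [hxx' (τ k) (mem_singleton_self _)]
  have hA : ∀ k, (({τ k} : Finset (Fin N)) ∩ A).card ≤ 1 := fun k =>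
    (card_le_card inter_subset_left).trans (by simp)
  have hAβ : ∀ j ∈ A, β j ≠ 0 := fun j hj => (mem_filter.mp hj).2
  have h := norm_twistedWinSum_le_of_transversal hN (fun k => {τ k}) (fun k x => G k (x (τ k))) hT β A hA hAβ
  have hwt : wt β = A.card := rfl
  rw [hwt, pow_one]
  refine h.trans ?_
  have hN2 : (2 : ℝ) ≤ (N : ℝ) := by exact_mod_cast (show 2 ≤ N by omega)
  have hpos : (0 : ℝ) ≤ (39 / 40 : ℝ) ^ A.card * (2 : ℝ) ^ N := by positivity
  nlinarith [hpos, hN2]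

end Blind39

namespace GradedSeeds38

open AffBells22

/-- **(R1) at `C = 0`, the literal instance of `TwistedJunta36.TwistedJuntaBoundX3S (39/40)`**: with `#(T k ∖ W) ≤ (log₂N)^0 = 1`
every bell reads `x|_W` and at most one outside letter; `A = supp β ∖ W` is a transversal; exponent `#(supp β ∖ W) / 1`.
(The hypothesis `3·#W ≤ N` of (R1) is not used.) -/
theorem twistedJuntaBoundX3S_zero :
    ∃ A n₀ : ℕ, ∀ N ≥ n₀,
      ∀ (W : Finset (Fin N)) (T : Fin N → Finset (Fin N)) (g : Fin N → (Fin N → Bool) → Bool),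
        3 * W.card ≤ N → (∀ k, (T k \ W).card ≤ (Nat.log 2 N) ^ 0) →
        (∀ k (x x' : Fin N → Bool), (∀ i ∈ T k, x i = x' i) → g k x = g k x') →
          ∀ β : Fin N → ZMod 3,
            ‖∑ x : Fin N → Bool, (ZMod.stdAddChar (∑ i : Fin N, if x i then β i else 0) : ℂ) *
                (if (OddZeros x ∧ RingHLF.Rel x (fun k => g k x)) then (1 : ℂ) else 0)‖
              ≤ (N : ℝ) ^ A * (39 / 40 : ℝ) ^ ((univ.filter fun i : Fin N => i ∉ W ∧ β i ≠ 0).card / (Nat.log 2 N) ^ 0)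
                  * (2 : ℝ) ^ N := by
  classical
  refine ⟨1, 3, fun N hN W T g _hW hT hg β => ?_⟩
  set A := univ.filter (fun j : Fin N => j ∉ W ∧ β j ≠ 0) with hAdef
  rw [pow_zero, Nat.div_one, pow_one]
  have hTr : ∀ k, ReadsOnly (T k) (g k) := fun k x x' h => hg k x x' h
  have hA : ∀ k, (T k ∩ A).card ≤ 1 := by
    intro k
    have hsub : T k ∩ A ⊆ T k \ W := by
      intro j hj
      rw [mem_inter] at hj
      exact mem_sdiff.mpr ⟨hj.1, (mem_filter.mp hj.2).2.1⟩
    have := hT k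
    rw [pow_zero] at this
    exact (card_le_card hsub).trans this
  have hAβ : ∀ j ∈ A, β j ≠ 0 := fun j hj => (mem_filter.mp hj).2.2
  have h := norm_twistedWinSum_le_of_transversal hN T g hTr β A hA hAβ
  refine h.trans ?_
  have hN2 : (2 : ℝ) ≤ (N : ℝ) := by exact_mod_cast (show 2 ≤ N by omega)
  have hpos : (0 : ℝ) ≤ (39 / 40 : ℝ) ^ A.card * (2 : ℝ) ^ N := by positivity
  nlinarith [hpos, hN2]

end GradedSeeds38

end Summit.QuantumAdvantage.AdviceFreeQNC0

end
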